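import Summits.HodgeConjecture.HodgeConjecture.Theorems.VHCAbelianSchemesRoadAnchorTransferPencil
import Literature.AlgebraicGeometry.ModuliOfAbelianVarieties.MumfordTateSubfamily
import Literature.AlgebraicGeometry.HodgeTheory.HodgeGenericQbarDescentFiniteMonodromyInputs
import Literature.AlgebraicGeometry.HodgeTheory.RelativeHyperplaneClassHodgeRiemann
import HarnessLib

/-!
# Road b02 (`VHCAbelianSchemesRoad`) — THE TRANSFER (T) OF STUB 2r″ FROM A WEIL-TYPE SUB-FAMILY DATUM: typed construction debt + kernel implication

research route conditional on HC_CM; not a corollary; Q11.4-sentence-2 already refuted in dim ≥ 3.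

Seat core-qb gen 0 (director-hodge g16 R16.39 (2) «(2r″-I)»; K0 memo `K0-2R-T-core-qb-g0.md` = evidence #50 on stmt-HodgeConjecture-26512),
helper `--supports stmt-HodgeConjecture-26512` for stub 2r″ `stub_localResidualPairs_63_OffHypDisjEndTwPrime`. Nothing here closes 2r″; the TRANSFER (T)
(`Theorems/VHCAbelianSchemesRoadAnchorReachableSeam.lean` :213, the `htransfer` binder of `localResidualPairs_63_offHypDisjEnd_of_offHypDisj_of_transfer`;
§5 there: 2r″ ⟺ 2r′ᵒᴴ ∧ (T)) is proved here FROM TWO DISPLAYED INPUTS, so that the K0's «XL» becomes named debt + a kernel theorem: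

* §1 `WeilTypeSubfamilyDatum P X w` — a sorry-free INTERFACE over the tree's Siegel universal family and its Mumford–Tate sub-families
  (`ModuliOfAbelianVarieties/SiegelModuliDatum.lean`, `…/MumfordTateSubfamily.lean`): «`(X, w)` is in WEIL POSITION for the presented pinned anchors `P`» said
  in tree words — a Mumford–Tate sub-family `T` of a Siegel datum `D` THROUGH A `P`-PRESENTED PINNED SECANT–QUOTIENT ANCHOR `(Y, θ)` (charted on `T`'s anchor
  fibre) one of whose fibres is (charted by) `X`, a rational class `w_Y ∈ 𝔖^pin(Y, θ) + ℂθ³`, and a global class `G` on `T`'s total space joining `w_Y` to `w`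
  (the `W_K ⊕ ⟨θ⟩`-constant system of the Weil-type Shimura sub-variety, André 1996 §6.3). The sub-family's OWN fields `classExtends` (Deligne 1982 Prop. 6.1 (c):
  every rational Hodge class at the anchor extends fibrewise-Hodge) and `dense_cmLocus` come BY NAME — nothing of them is restated.
* §2 `RhoOneAtPinnedAnchors P` — DISPLAYED (`@[conjecture] def`, Theorems-side, parameterised; NOT a Literature fact): every non-Lefschetz rational `(3,3)`
  pair on an abelian sixfold that is reachable from an H-good off-hyperelliptic presented pinned anchor (v3.11's oH) is in Weil position for `P`. On paper
  this is LEAD 163's (ρ1) («the 𝔘-extension clause confines reachability pencils to the Weil-type Shimura variety `S_K`», ring2 INBOX l.5579) made explicit —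
  `Fix_{GSp}(span 𝔖^pin(Y_D) ∪ {θ}) ⊆ G_Weil` at EVERY presented oH anchor (the converse direction of André §6.3) — TOGETHER WITH the existence of `S_K` as a
  Mumford–Tate sub-family through a very general, `End`-trivial, secant–quotient point (Ciliberto–van der Geer–Teixidor 1992; Cattani–Deligne–Kaplan 1995).
  It is the Shimura-theoretic content of the D1b″ plan and is NOT claimed.
* §3 the curve input is displayed INLINE as the binder `hcurve` («through two points of a smooth irreducible quasi-projective `B` passes (the image of) a
  smooth irreducible affine curve» — Mumford, *Abelian Varieties* §6 Lemma, plus normalisation and an affine open; no `def`, nothing registered), and the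
  KERNEL theorems: `anchorReachableAt_of_weilTypeSubfamilyDatum` (restrict the sub-family to the curve — `familyPullback.snd`,
  `IsSmoothProjectiveFamily.familyPullback_snd`, `isQuasiProjectiveOver_familyPullback_of_isSeparated`; transport `classExtends` through
  `fiberOverFamilyPullbackIso` ∕ `fiberOverFamilyPullbackIso_hom_fiberι` and the charts; conclude by `anchorReachableAt_63_secantQuotientPinned_of_pencil_classExtends`,
  p660843) and **`transfer_63_offHypDisjEnd_of_rhoOne` : `RhoOneAtPinnedAnchors oHE → hcurve → (T)` VERBATIM** (left disjunct).

References: [Markman2025SecantWeil] §1.5, Thm. 1.5.1; [Deligne1982HodgeCycles] Prop. 6.1; [CharlesSchnell2014Notes] Thm. 11.5.11; [Andre1996Motifs] §6.3;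
[MumfordAV1970] §6 Lemma (p. 56); [CattaniDeligneKaplan1995] Cor. 1.3.
-/
noncomputable section

open CategoryTheory CategoryTheory.Limits AlgebraicGeometry Topology MonoidalCategory CartesianMonoidalCategory

namespace Summit.HodgeConjecture.HodgeConjecture.Ring2.SemiregularRepresentatives

set_option linter.dupNamespace false -- the cell's namespace repeats the summit name, as in every `Ring2*` file

open Literature.AlgebraicGeometry Literature.AlgebraicGeometry.Motives Literature.AlgebraicGeometry.Motives.AbelianVariety
open Literature.AlgebraicGeometry.HodgeTheory Literature.AlgebraicGeometry.Markman2025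
open Literature.AlgebraicGeometry.ModuliOfAbelianVarieties
open Literature.AlgebraicTopology.SingularHomology
open Literature.Barriers.HodgeConjecture (divisorClassesSpan)
open Summit.Ventures.HSemireg (ObjClass)

/-! ## §1 The interface: Weil position of a pair relative to the presented pinned anchors -/

/-- **`WeilTypeSubfamilyDatum P X w` — `(X, w)` is in WEIL POSITION for the `P`-presented pinned secant–quotient anchors** (hypothesis structure,
output-shaped fields only, over the tree's Siegel universal family): a Siegel fine-moduli datum `D` of genus `6`, a Mumford–Tate sub-family `T` of `D`
(Deligne 1982 Prop. 6.1 ∕ Charles–Schnell Thm. 11.5.11, the tree's `SiegelModuliDatum.MumfordTateSubfamily` — it carries `classExtends` and `dense_cmLocus`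
as its own fields) whose ANCHOR fibre is charted by a `P`-presented pinned secant–quotient anchor `(Y, θ)`, a point `b` of its base whose fibre is charted by
`X`, a rational class `w_Y ∈ 𝔖^pin(Y, θ) + ℂθ³` (or `ℂθ³`), and a global class `G` on the total space `T.B ×_{D.S} D.𝒳` restricting to `w_Y` on the anchor
fibre and to `w` on the fibre over `b` (on paper: `T` = the Weil-type Shimura sub-variety `S_K` through a very general `End`-trivial secant–quotient point,
`G` = the section of the constant system `W_K ⊕ ⟨θ⟩` through `w`, André §6.3). Nothing asserted. [cite: Deligne1982HodgeCycles, Prop. 6.1]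
[cite: CharlesSchnell2014Notes, Thm. 11.5.11] [cite: Andre1996Motifs, §6.3] [cite: Markman2025SecantWeil, §1.5 and Thm. 1.5.1] -/
structure WeilTypeSubfamilyDatum (P : ∀ Y : SchemeOver ℂ, complexBetti Y 2 → Prop) (X : SchemeOver ℂ) (w : complexBetti X (2 * 3)) where
  /-- the polarisation type of the Siegel datum. -/
  δ : Fin 6 → ℕ
  /-- the level of the Siegel datum. -/
  N : ℕ
  /-- the Siegel fine-moduli datum of genus `6` (universal family `D.f : D.𝒳 ⟶ D.S`). -/
  D : SiegelModuliDatum 6 δ N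
  /-- the moduli point of the anchor. -/
  s₀ : ComplexPoints D.S
  /-- the Mumford–Tate sub-family through `s₀` (in print: the Weil-type Shimura sub-variety `S_K`). -/
  T : D.MumfordTateSubfamily s₀
  /-- the anchor sixfold. -/
  Y : SchemeOver ℂ
  /-- its polarisation class. -/
  θ : complexBetti Y 2
  /-- the anchor chart: the anchor fibre of `T` is `Y`. -/
  eY : fiberOver T.f T.b₀ ≅ Y
  /-- `(Y, θ)` is a `P`-presented pinned secant–quotient anchor. -/
  anchor : secantQuotientAnchorsPinned Y θ ∧ P Y θ
  /-- the moduli point of the target in the sub-family. -/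
  b : ComplexPoints T.B
  /-- the target chart: the fibre of `T` over `b` is `X`. -/
  eX : fiberOver T.f b ≅ X
  /-- the class at the anchor joined to `w`. -/
  wY : complexBetti Y (2 * 3)
  /-- it lies in `𝔖^pin(Y, θ) + ℂθ³` (or on `ℂθ³`). -/
  wY_mem : wY ∈ {w | ∃ γ, (γ = 0 ∨ γ ∈ secantQuotientServedClassesPinned Y θ) ∧ ∃ z : ℂ, w = γ + z • cupPowTwo θ 3}
  /-- it is rational. -/
  wY_rational : IsRationalClass wY
  /-- the joining class on the total space of the sub-family. -/
  G : complexBetti T.total (2 * 3)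
  /-- `G` restricts to `w_Y` on the anchor fibre. -/
  G_b₀ : complexBetti.map (fiberι T.f T.b₀) (2 * 3) G = complexBetti.map eY.hom (2 * 3) wY
  /-- `G` restricts to `w` on the fibre over `b`. -/
  G_b : complexBetti.map (fiberι T.f b) (2 * 3) G = complexBetti.map eX.hom (2 * 3) w

/-! ## §2 The displayed Shimura-theoretic input (ρ1) -/

/-- **(ρ1) at the pinned anchors, displayed** (`P` = the presentation predicate of the NEW anchors; for the transfer (T) of stub 2r″, `P` = v3.12's oHE:
non-hyperelliptic ∧ `OrbitTranslatesDisjoint` ∧ pin ∧ `End J = ℤ`): every pair `(X, w)` — `X` isomorphic to an abelian sixfold, `w` rational of type `(3,3)`,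
not algebraic-Lefschetz — that is REACHABLE from an H-good off-hyperelliptic presented pinned anchor (v3.11's oH, verbatim) is in Weil position for `P`
(`WeilTypeSubfamilyDatum P X w` is non-empty). On paper: the `𝔘`-extension clause of the oH-pencil confines it to the Weil-type Shimura sub-variety `S_K`
(`Fix_{GSp}(span 𝔖^pin ∪ {θ}) ⊆ G_Weil` at every presented oH anchor — LEAD 163 (ρ1), the converse direction of André §6.3), `S_K` is a Mumford–Tate
sub-family through a very general secant–quotient point, which is `End`-trivial (Ciliberto–van der Geer–Teixidor i Bigas 1992; Cattani–Deligne–Kaplan 1995),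
and `W_K ⊕ ⟨θ⟩` is a constant system on `S_K` (André §6.3). DISPLAYED — NOT CLAIMED; Theorems-side debt of the D1b″ plan, not a Literature fact.
[cite: Andre1996Motifs, §6.3] [cite: CattaniDeligneKaplan1995, Cor. 1.3] [cite: Markman2025SecantWeil, §1.5 (p. 7) and Thm. 1.5.1] -/
@[conjecture]
def RhoOneAtPinnedAnchors (P : ∀ Y : SchemeOver ℂ, complexBetti Y 2 → Prop) : Prop :=
  ∀ (X : SchemeOver ℂ), (∃ A' : AbelianVariety ℂ, A'.dim = 6 ∧ Nonempty (A'.X ≅ X)) →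
    ∀ w : complexBetti X (2 * 3), IsRationalClass w → IsOfHodgeType 6 X (2 * 3) 3 3 w →
      ¬ (w ∈ algebraicClasses X 3 ∧ w ∈ divisorClassesSpan X 6 3) →
      AnchorReachableAt 6 3
          (fun Y θ ↦ secantQuotientAnchorsPinned Y θ ∧ ∃ (D : SecantQuotientDatum) (e : Y ≅ D.Y.X) (θ₀ : complexBetti D.𝒥.J.X 2),
            ¬ D.𝒥.IsHyperelliptic ∧ OrbitTranslatesDisjoint D.𝒥 D.G₁ D.G₂ ∧ D.𝒥.J.IsPolarizationClassOf D.Θ θ₀ ∧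
            complexBetti.map e.inv 2 θ = D.hY θ₀)
          (fun Y θ ↦ secantQuotientServedClassesPinned Y θ)
          (fun Y θ ↦ {w | ∃ γ, (γ = 0 ∨ γ ∈ secantQuotientServedClassesPinned Y θ) ∧ ∃ z : ℂ, w = γ + z • cupPowTwo θ 3}) X w →
        Nonempty (WeilTypeSubfamilyDatum P X w)

/-! ## §3 The kernel: Weil position + a curve through the two moduli points ⟹ reachability; the transfer (T) -/

/-- Transport of the fibre inclusion along an equality of points (auxiliary). [folklore] -/
private theorem exists_iso_fiberOver_of_eq {𝒳 S : SchemeOver ℂ} (f : 𝒳 ⟶ S) {b b' : ComplexPoints S} (h : b = b') :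
    ∃ e : fiberOver f b ≅ fiberOver f b', e.hom ≫ fiberι f b' = fiberι f b := by
  subst h
  exact ⟨Iso.refl _, Category.id_comp _⟩

/-- `(g ≫ h)^* a = g^* (h^* a)` on classes (auxiliary). [folklore] -/
private theorem complexBetti_map_comp_apply {X₁ X₂ X₃ : SchemeOver ℂ} (g : X₁ ⟶ X₂) (h : X₂ ⟶ X₃) (i : ℕ) (a : complexBetti X₃ i) :
    complexBetti.map (g ≫ h) i a = complexBetti.map g i (complexBetti.map h i a) := by
  rw [complexBetti.map_comp, ModuleCat.comp_apply]

/-- **WEIL POSITION + A CURVE THROUGH THE TWO MODULI POINTS ⟹ ANCHOR-REACHABILITY** (the kernel of the D1b″ plan). Given `Q : WeilTypeSubfamilyDatum P X w`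
and the curve input `hcurve` («through any two points of a smooth irreducible quasi-projective `B` passes the image of a smooth irreducible affine curve»,
Mumford AV §6 Lemma with normalisation and an affine open — DISPLAYED as a binder), the pencil is the restriction `C ×_{T.B} (T.B ×_{D.S} D.𝒳) ⟶ C` of the
sub-family to the curve: smooth projective of relative dimension `6` (`IsSmoothProjectiveFamily.familyPullback_snd`), quasi-projective total space
(`isQuasiProjectiveOver_familyPullback_of_isSeparated`), its fibres over `c₁ ↦ b₀`, `c₂ ↦ b` charted by `Y` and `X` through `fiberOverFamilyPullbackIso`;
the sub-family's `classExtends` at `b₀`, pulled back along `C ×_{T.B} (…) ⟶ T.B ×_{D.S} D.𝒳`, is the extension hypothesis of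
`anchorReachableAt_63_secantQuotientPinned_of_pencil_classExtends`, and the pulled-back `G` joins `w_Y` to `w`.
[cite: MumfordAV1970, §6 Lemma (p. 56)] [cite: Deligne1982HodgeCycles, Prop. 6.1] [cite: Markman2025SecantWeil, §1.5 and Thm. 1.5.1] -/
theorem anchorReachableAt_of_weilTypeSubfamilyDatum {P : ∀ Y : SchemeOver ℂ, complexBetti Y 2 → Prop} {X : SchemeOver ℂ}
    {w : complexBetti X (2 * 3)} (Q : WeilTypeSubfamilyDatum P X w)
    (hcurve : ∀ (B : SchemeOver ℂ), IrreducibleSpace B.left → AlgebraicGeometry.Smooth B.hom → IsQuasiProjectiveOver B →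
      ∀ b₁ b₂ : ComplexPoints B, ∃ (C : SchemeOver ℂ) (ι : C ⟶ B) (_ : IrreducibleSpace C.left) (_ : IsAffine C.left),
        AlgebraicGeometry.Smooth C.hom ∧ topologicalKrullDim C.left = 1 ∧ IsQuasiProjectiveOver C ∧
        ∃ c₁ c₂ : ComplexPoints C, AlgPoints.map ι c₁ = b₁ ∧ AlgPoints.map ι c₂ = b₂) :
    AnchorReachableAt 6 3 (fun Y θ ↦ secantQuotientAnchorsPinned Y θ ∧ P Y θ)
      (fun Y θ ↦ secantQuotientServedClassesPinned Y θ)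
      (fun Y θ ↦ {w | ∃ γ, (γ = 0 ∨ γ ∈ secantQuotientServedClassesPinned Y θ) ∧ ∃ z : ℂ, w = γ + z • cupPowTwo θ 3}) X w := by
  obtain ⟨C, ι, hCirr, hCaff, hCsm, hCdim, hCqp, c₁, c₂, hc₁, hc₂⟩ := hcurve Q.T.B Q.T.irreducibleSpace_base Q.T.smooth_base
    Q.T.isQuasiProjectiveOver_base Q.T.b₀ Q.b
  haveI := hCirr
  haveI := hCaff
  -- the pencil: the sub-family restricted to the curve
  have hf' : IsSmoothProjectiveFamily (familyPullback.snd Q.T.f ι) 6 := Q.T.isSmoothProjectiveFamily.familyPullback_snd ι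
  haveI : IsSeparated Q.T.B.hom := Q.T.isQuasiProjectiveOver_base.isSeparated
  have h𝒳' : IsQuasiProjectiveOver (familyPullback Q.T.f ι) :=
    isQuasiProjectiveOver_familyPullback_of_isSeparated Q.T.f ι Q.T.isQuasiProjectiveOver_total hCqp
  -- fibre identifications along the curve and at the two marked points
  have eFP : ∀ u : ComplexPoints C, ∃ e : fiberOver (familyPullback.snd Q.T.f ι) u ≅ fiberOver Q.T.f (AlgPoints.map ι u),
      e.hom ≫ fiberι Q.T.f (AlgPoints.map ι u) = fiberι (familyPullback.snd Q.T.f ι) u ≫ familyPullback.fst Q.T.f ι :=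
    fun u ↦ ⟨fiberOverFamilyPullbackIso Q.T.f ι u, fiberOverFamilyPullbackIso_hom_fiberι Q.T.f ι u⟩
  obtain ⟨e₁, he₁⟩ := eFP c₁
  obtain ⟨e₂, he₂⟩ := eFP c₂
  obtain ⟨d₁, hd₁⟩ := exists_iso_fiberOver_of_eq Q.T.f hc₁
  obtain ⟨d₂, hd₂⟩ := exists_iso_fiberOver_of_eq Q.T.f hc₂
  -- restriction of a pulled-back class to the fibre over `u` = chart-transport of the restriction over `ι u`
  have hres : ∀ (u : ComplexPoints C) (e : fiberOver (familyPullback.snd Q.T.f ι) u ≅ fiberOver Q.T.f (AlgPoints.map ι u)),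
      e.hom ≫ fiberι Q.T.f (AlgPoints.map ι u) = fiberι (familyPullback.snd Q.T.f ι) u ≫ familyPullback.fst Q.T.f ι →
      ∀ (k : ℕ) (W : complexBetti Q.T.total k),
        complexBetti.map (fiberι (familyPullback.snd Q.T.f ι) u) k (complexBetti.map (familyPullback.fst Q.T.f ι) k W) =
          complexBetti.map e.hom k (complexBetti.map (fiberι Q.T.f (AlgPoints.map ι u)) k W) := by
    intro u e he k W
    rw [← complexBetti_map_comp_apply, ← he, complexBetti_map_comp_apply]
  -- at the marked points, further transport along `d₁`, `d₂`
  have hres₁ : ∀ (k : ℕ) (W : complexBetti Q.T.total k),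
      complexBetti.map (fiberι (familyPullback.snd Q.T.f ι) c₁) k (complexBetti.map (familyPullback.fst Q.T.f ι) k W) =
        complexBetti.map (e₁ ≪≫ d₁).hom k (complexBetti.map (fiberι Q.T.f Q.T.b₀) k W) := by
    intro k W
    rw [hres c₁ e₁ he₁, Iso.trans_hom, complexBetti_map_comp_apply, ← complexBetti_map_comp_apply d₁.hom, hd₁]
  have hres₂ : ∀ (k : ℕ) (W : complexBetti Q.T.total k),
      complexBetti.map (fiberι (familyPullback.snd Q.T.f ι) c₂) k (complexBetti.map (familyPullback.fst Q.T.f ι) k W) =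
        complexBetti.map (e₂ ≪≫ d₂).hom k (complexBetti.map (fiberι Q.T.f Q.b) k W) := by
    intro k W
    rw [hres c₂ e₂ he₂, Iso.trans_hom, complexBetti_map_comp_apply, ← complexBetti_map_comp_apply d₂.hom, hd₂]
  -- the charts of the pencil
  let eY' : fiberOver (familyPullback.snd Q.T.f ι) c₁ ≅ Q.Y := (e₁ ≪≫ d₁) ≪≫ Q.eY
  let eX' : fiberOver (familyPullback.snd Q.T.f ι) c₂ ≅ X := (e₂ ≪≫ d₂) ≪≫ Q.eX
  refine anchorReachableAt_63_secantQuotientPinned_of_pencil_classExtends (P := P) (familyPullback.snd Q.T.f ι) hf' h𝒳' hCsm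
    hCdim c₁ c₂ eY' eX' Q.anchor ?_ Q.wY_mem Q.wY_rational (complexBetti.map (familyPullback.fst Q.T.f ι) (2 * 3) Q.G) ?_ ?_
  · -- class extension at the anchor of the pencil, from the sub-family's `classExtends`
    intro q c hcQ hcH
    have hcQ' : IsRationalClass (complexBetti.map Q.eY.hom (2 * q) c) := (isRationalClass_map_iff_of_iso Q.eY).2 hcQ
    have hcH' : IsOfHodgeType 6 (fiberOver Q.T.f Q.T.b₀) (2 * q) q q (complexBetti.map Q.eY.hom (2 * q) c) :=
      (isOfHodgeType_map_iff_of_iso Q.eY).2 hcH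
    obtain ⟨W, hW, hWb₀⟩ := Q.T.classExtends q (complexBetti.map Q.eY.hom (2 * q) c) hcQ' hcH'
    refine ⟨complexBetti.map (familyPullback.fst Q.T.f ι) (2 * q) W, fun u ↦ ?_, ?_⟩
    · obtain ⟨e, he⟩ := eFP u
      rw [hres u e he]
      exact ⟨(isRationalClass_map_iff_of_iso e).2 (hW (AlgPoints.map ι u)).1,
        (isOfHodgeType_map_iff_of_iso e).2 (hW (AlgPoints.map ι u)).2⟩
    · rw [hres₁, hWb₀, Iso.trans_hom ((e₁ ≪≫ d₁)) Q.eY, complexBetti_map_comp_apply]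
  · -- the joining class at the anchor
    rw [hres₁, Q.G_b₀, Iso.trans_hom ((e₁ ≪≫ d₁)) Q.eY, complexBetti_map_comp_apply]
  · -- the joining class at the target
    rw [hres₂, Q.G_b, Iso.trans_hom ((e₂ ≪≫ d₂)) Q.eX, complexBetti_map_comp_apply]

/-- **THE TRANSFER (T) OF STUB 2r″ FROM (ρ1) AND THE CURVE LEMMA** — VERBATIM the `htransfer` hypothesis of
`localResidualPairs_63_offHypDisjEnd_of_offHypDisj_of_transfer` (`…AnchorReachableSeam.lean` :213), for every door `𝒪` (the LEFT disjunct is proved):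
«every non-Lefschetz rational `(3,3)` pair on an abelian sixfold reachable from an H-good off-hyperelliptic presented pinned anchor (oH) is reachable from an
`End`-TRIVIAL one (oHE)», GIVEN (ρ1) at the oHE anchors (`RhoOneAtPinnedAnchors`, displayed: the pair is in Weil position) and the curve input `hcurve`
(Mumford AV §6 Lemma, displayed inline). So 2r″ = 2r′ᵒᴴ ∧ (T) (b03x §5) with (T) ⟸ (ρ1) ∧ «curve through two points» in the kernel; the Shimura geometry of
D1b″ is exactly `RhoOneAtPinnedAnchors oHE`. [cite: Markman2025SecantWeil, §1.5 (p. 7) and Thm. 1.5.1] [cite: Andre1996Motifs, §6.3]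
[cite: MumfordAV1970, §6 Lemma (p. 56)] [cite: Deligne1982HodgeCycles, Prop. 6.1] -/
theorem transfer_63_offHypDisjEnd_of_rhoOne {𝒪 : ObjClass}
    (hρ : RhoOneAtPinnedAnchors (fun Y θ ↦ ∃ (D : SecantQuotientDatum) (e : Y ≅ D.Y.X) (θ₀ : complexBetti D.𝒥.J.X 2),
      ¬ D.𝒥.IsHyperelliptic ∧ OrbitTranslatesDisjoint D.𝒥 D.G₁ D.G₂ ∧ D.𝒥.J.IsPolarizationClassOf D.Θ θ₀ ∧
      (∀ f : D.𝒥.J ⟶ D.𝒥.J, ∃ n : ℤ, f = n • 𝟙 D.𝒥.J) ∧ complexBetti.map e.inv 2 θ = D.hY θ₀))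
    (hcurve : ∀ (B : SchemeOver ℂ), IrreducibleSpace B.left → AlgebraicGeometry.Smooth B.hom → IsQuasiProjectiveOver B →
      ∀ b₁ b₂ : ComplexPoints B, ∃ (C : SchemeOver ℂ) (ι : C ⟶ B) (_ : IrreducibleSpace C.left) (_ : IsAffine C.left),
        AlgebraicGeometry.Smooth C.hom ∧ topologicalKrullDim C.left = 1 ∧ IsQuasiProjectiveOver C ∧
        ∃ c₁ c₂ : ComplexPoints C, AlgPoints.map ι c₁ = b₁ ∧ AlgPoints.map ι c₂ = b₂) :
    ∀ (X : SchemeOver ℂ), (∃ A' : AbelianVariety ℂ, A'.dim = 6 ∧ Nonempty (A'.X ≅ X)) →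
      ∀ w : complexBetti X (2 * 3), IsRationalClass w → IsOfHodgeType 6 X (2 * 3) 3 3 w →
        ¬ (w ∈ algebraicClasses X 3 ∧ w ∈ divisorClassesSpan X 6 3) →
        AnchorReachableAt 6 3
            (fun Y θ ↦ secantQuotientAnchorsPinned Y θ ∧ ∃ (D : SecantQuotientDatum) (e : Y ≅ D.Y.X) (θ₀ : complexBetti D.𝒥.J.X 2),
              ¬ D.𝒥.IsHyperelliptic ∧ OrbitTranslatesDisjoint D.𝒥 D.G₁ D.G₂ ∧ D.𝒥.J.IsPolarizationClassOf D.Θ θ₀ ∧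
              complexBetti.map e.inv 2 θ = D.hY θ₀)
            (fun Y θ ↦ secantQuotientServedClassesPinned Y θ)
            (fun Y θ ↦ {w | ∃ γ, (γ = 0 ∨ γ ∈ secantQuotientServedClassesPinned Y θ) ∧ ∃ z : ℂ, w = γ + z • cupPowTwo θ 3}) X w →
        AnchorReachableAt 6 3
            (fun Y θ ↦ secantQuotientAnchorsPinned Y θ ∧ ∃ (D : SecantQuotientDatum) (e : Y ≅ D.Y.X) (θ₀ : complexBetti D.𝒥.J.X 2),
              ¬ D.𝒥.IsHyperelliptic ∧ OrbitTranslatesDisjoint D.𝒥 D.G₁ D.G₂ ∧ D.𝒥.J.IsPolarizationClassOf D.Θ θ₀ ∧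
              (∀ f : D.𝒥.J ⟶ D.𝒥.J, ∃ n : ℤ, f = n • 𝟙 D.𝒥.J) ∧ complexBetti.map e.inv 2 θ = D.hY θ₀)
            (fun Y θ ↦ secantQuotientServedClassesPinned Y θ)
            (fun Y θ ↦ {w | ∃ γ, (γ = 0 ∨ γ ∈ secantQuotientServedClassesPinned Y θ) ∧ ∃ z : ℂ, w = γ + z • cupPowTwo θ 3}) X w ∨
        LocallyServedAt 𝒪 6 3 X w := by
  intro X hX w hwQ hwH hL hreach
  obtain ⟨Q⟩ := hρ X hX w hwQ hwH hL hreach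
  exact Or.inl (anchorReachableAt_of_weilTypeSubfamilyDatum Q hcurve)

end Summit.HodgeConjecture.HodgeConjecture.Ring2.SemiregularRepresentatives

end
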